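import Summits.ResolutionOfSingularities.KangarooAtlas.MizutaniPTowerFin
import Mathlib.RingTheory.LocalRing.ResidueField.Basic
import Mathlib.RingTheory.TensorProduct.Basic
import HarnessLib

/-!
# Mizutani's conjecture — partial coefficient fields of `O/𝔪^q` and the tensor-square kernel argument

Cell topic `Summits/ResolutionOfSingularities/KangarooAtlas` (pub-rosobs); namespace
`Summit.ResolutionOfSingularities.KangarooAtlas.Mizutani`.  Companion to the Lean transcription of the in-house
note MIZUTANI-PROOF-g59 (AI-written, AI-audited; *AI review is weaker than expert review*; not a resolution
theorem).  This file is the abstract heart of the proof of ODA'S EQUALITY `U(𝔭) ∩ L_e = (L_B)_e`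
(Oda 1973 Prop. 2.2 (ii), quoted in Oda 1983-II p. 1168; the inclusion `⊇` missing from
`MizutaniMultiplicity.lean`), carried out in `MizutaniOdaEquality.lean`.

Let `(O, 𝔪, κ)` be a local ring of characteristic `p`, `q = p^e`, `Ō = O/𝔪^q`, `res : Ō → κ`.

* `frobLift` — the `q`-th power map DESCENDS to a ring homomorphism `λ : κ → Ō`, `λ(ȳ) = y^q`
  (`(y + m)^q = y^q + m^q` and `m^q ∈ 𝔪^q`); `res ∘ λ = F^e`, `λ ∘ res = F^e`.  Through the inverse of
  `F^e : κ ≅ κ^q` (`frobPowEquiv`) this makes `Ō` an algebra over the subfield `κ^q = frobPow κ p e`.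
* **`coeffLift`** (a PARTIAL COEFFICIENT FIELD) — for a finite `p`-independent family `b` of `κ`
  (`PIndep`, `MizutaniPIndependent`), the root-tower universal property of `κ^q(b)`
  (`isRootTower_adjoin`, `IsRootTower.lift`) gives a `κ^q`-algebra map `σ : κ^q(b) → Ō` lifting the
  inclusion `κ^q(b) ⊂ κ` (`res_coeffLift`): ANY lifts of the `b_i` will do, because `ỹ^q = λ(b_i)` holds for
  every lift `ỹ` of `b_i`.  No `p`-basis of `κ`, no Zorn.
* **`tensorKer`** — for a field `k` mapping to `O` with `K = k^q`, an intermediate field `K ⊆ F ⊆ k` whose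
  image in `κ` lies in `κ^q(b)`, the ring homomorphism `Θ = ι ⊗ (σ ∘ incl) : F ⊗_K F → Ō` is well defined —
  on `K` both factors agree BECAUSE every element of `K` is a `q`-th power (`ι(c^q) = ι(c)^q = λ(c̄) = σ(c^q)`) —
  and it maps the diagonal ideal `J_F` into `𝔪̄ = ker res`, hence `J_F^q` to `𝔪̄^q = 0`
  (`tensorKer_eq_zero_of_mem_pow`).

References: [Oda1983HironakaGroupSchemeII] §2 (p. 1168); [Mizutani1973HironakaGroupSchemes] Lemma 2.4 (p. 88:
the finite `p`-independent envelope); [EGAIV4] §16.8 (principal parts `(A ⊗ A)/J^{m+1}`).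
-/

open TensorProduct Literature.AlgebraicGeometry.Resolution.HironakaScheme

namespace Summit.ResolutionOfSingularities.KangarooAtlas.Mizutani

universe u v

/-! ## The truncation `Ō = O/𝔪^q` and the Frobenius lift `λ : κ → Ō` -/

section Trunc

variable (O : Type v) [CommRing O] [IsLocalRing O] (p : ℕ) [hp : Fact p.Prime] (e : ℕ)

/-- `Ō = O / 𝔪^{p^e}`. [folklore] -/
abbrev Trunc := O ⧸ IsLocalRing.maximalIdeal O ^ p ^ e

/-- The projection `π : O → O/𝔪^q`. [folklore] -/
noncomputable abbrev truncMk : O →+* Trunc O p e := Ideal.Quotient.mk _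

/-- `𝔪^q ≤ 𝔪`. [folklore] -/
theorem maximalIdeal_pow_le : IsLocalRing.maximalIdeal O ^ p ^ e ≤ IsLocalRing.maximalIdeal O :=
  Ideal.pow_le_self (pow_ne_zero e hp.out.ne_zero)

/-- The residue map `res : O/𝔪^q → κ = O/𝔪`. [folklore] -/
noncomputable def truncRes : Trunc O p e →+* IsLocalRing.ResidueField O :=
  Ideal.Quotient.factor (maximalIdeal_pow_le O p e)

/-- `res (π y) = ȳ`. [folklore] -/
@[simp] theorem truncRes_mk (y : O) : truncRes O p e (truncMk O p e y) = IsLocalRing.residue O y := rfl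

/-- `res` is surjective. [folklore] -/
theorem truncRes_surjective : Function.Surjective (truncRes O p e) := by
  intro x
  obtain ⟨y, rfl⟩ := IsLocalRing.residue_surjective x
  exact ⟨truncMk O p e y, rfl⟩

/-- The image `𝔪̄ = 𝔪/𝔪^q` of the maximal ideal. [folklore] -/
noncomputable abbrev truncMax : Ideal (Trunc O p e) := (IsLocalRing.maximalIdeal O).map (truncMk O p e)

/-- `res x = 0 ⇒ x ∈ 𝔪̄`. [folklore] -/
theorem mem_truncMax_of_truncRes_eq_zero {x : Trunc O p e} (hx : truncRes O p e x = 0) : x ∈ truncMax O p e := by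
  obtain ⟨y, rfl⟩ := Ideal.Quotient.mk_surjective x
  rw [truncRes_mk, IsLocalRing.residue_eq_zero_iff] at hx
  exact Ideal.mem_map_of_mem _ hx

omit hp in
/-- **`𝔪̄^q = 0` in `O/𝔪^q`.** [folklore] -/
theorem truncMax_pow_eq_bot : truncMax O p e ^ p ^ e = ⊥ := by
  rw [← Ideal.map_pow, Ideal.map_quotient_self]

omit hp in
/-- `y ∈ 𝔪 ⇒ y^q ∈ 𝔪^q`, so the `q`-th power map kills `𝔪` modulo `𝔪^q`. [folklore] -/
theorem frob_mem_pow {y : O} (hy : y ∈ IsLocalRing.maximalIdeal O) :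
    truncMk O p e (y ^ p ^ e) = 0 :=
  (Ideal.Quotient.eq_zero_iff_mem).mpr (Ideal.pow_mem_pow hy _)

variable [CharP O p]

/-- **The Frobenius lift `λ : κ → O/𝔪^q`, `λ(ȳ) = y^q`** — well defined since `(y + m)^q = y^q + m^q` and
`m^q ∈ 𝔪^q`. [folklore] -/
noncomputable def frobLift : IsLocalRing.ResidueField O →+* Trunc O p e :=
  Ideal.Quotient.lift (IsLocalRing.maximalIdeal O) ((truncMk O p e).comp (iterateFrobenius O p e)) (by
    intro y hy
    rw [RingHom.comp_apply, iterateFrobenius_def]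
    exact frob_mem_pow O p e hy)

/-- `λ(ȳ) = π(y^q)`. [folklore] -/
theorem frobLift_residue' (y : O) : frobLift O p e (IsLocalRing.residue O y) = truncMk O p e (y ^ p ^ e) := by
  show ((truncMk O p e).comp (iterateFrobenius O p e)) y = _
  rw [RingHom.comp_apply, iterateFrobenius_def]

/-- `λ(ȳ) = π(y)^q`. [folklore] -/
@[simp] theorem frobLift_residue (y : O) : frobLift O p e (IsLocalRing.residue O y) = truncMk O p e y ^ p ^ e := by
  rw [frobLift_residue', map_pow]

/-- `λ(res x) = x^q` for `x ∈ O/𝔪^q`. [folklore] -/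
theorem frobLift_truncRes (x : Trunc O p e) : frobLift O p e (truncRes O p e x) = x ^ p ^ e := by
  obtain ⟨y, rfl⟩ := Ideal.Quotient.mk_surjective x
  exact frobLift_residue O p e y

/-- `res (λ x) = x^q`. [folklore] -/
theorem truncRes_frobLift (x : IsLocalRing.ResidueField O) : truncRes O p e (frobLift O p e x) = x ^ p ^ e := by
  obtain ⟨y, rfl⟩ := IsLocalRing.residue_surjective x
  rw [frobLift_residue, map_pow, truncRes_mk]

end Trunc

/-! ## `F^e : κ ≅ κ^{p^e}` and the `κ^{p^e}`-algebra structure of `O/𝔪^q` -/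

section FrobPowEquiv

variable (κ : Type v) [Field κ] (p : ℕ) [Fact p.Prime] [CharP κ p] (e : ℕ)

/-- `F^e : κ ≅ κ^{p^e}` (a field isomorphism onto the subfield of `p^e`-th powers). [folklore] -/
noncomputable def frobPowEquiv : κ ≃+* frobPow κ p e :=
  RingEquiv.ofBijective (iterateFrobenius κ p e).rangeRestrictField
    (RingHom.rangeRestrictField_bijective _)

/-- `(F^e x : κ) = x^{p^e}`. [folklore] -/
@[simp] theorem coe_frobPowEquiv (x : κ) : ((frobPowEquiv κ p e x : frobPow κ p e) : κ) = x ^ p ^ e := by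
  show ((iterateFrobenius κ p e).rangeRestrictField x : κ) = x ^ p ^ e
  rw [RingHom.coe_rangeRestrictField, iterateFrobenius_def]

/-- `(F^e)⁻¹ z` is the `p^e`-th root: `((F^e)⁻¹ z)^{p^e} = z`. [folklore] -/
theorem frobPowEquiv_symm_pow (z : frobPow κ p e) : ((frobPowEquiv κ p e).symm z) ^ p ^ e = (z : κ) := by
  conv_rhs => rw [← (frobPowEquiv κ p e).apply_symm_apply z]
  rw [coe_frobPowEquiv]

/-- `(F^e)⁻¹ ⟨x^{p^e}⟩ = x`. [folklore] -/
theorem frobPowEquiv_symm_mk (x : κ) (hx : x ^ p ^ e ∈ frobPow κ p e) :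
    (frobPowEquiv κ p e).symm ⟨x ^ p ^ e, hx⟩ = x := by
  apply (frobPowEquiv κ p e).injective
  rw [RingEquiv.apply_symm_apply]
  exact Subtype.ext (coe_frobPowEquiv κ p e x).symm

end FrobPowEquiv

section TruncAlgebra

variable (O : Type v) [CommRing O] [IsLocalRing O] (p : ℕ) [hp : Fact p.Prime] [CharP O p] (e : ℕ)
  [CharP (IsLocalRing.ResidueField O) p]

/-- **`O/𝔪^q` as a `κ^q`-algebra**: `z ↦ λ((F^e)⁻¹ z)`, i.e. `y^q ↦ ỹ^q` for any lift `ỹ` of `y`. [folklore] -/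
noncomputable instance algebraFrobPowTrunc : Algebra (frobPow (IsLocalRing.ResidueField O) p e) (Trunc O p e) :=
  ((frobLift O p e).comp (frobPowEquiv (IsLocalRing.ResidueField O) p e).symm.toRingHom).toAlgebra

/-- The structure map unfolded. [folklore] -/
theorem algebraMap_frobPow_trunc (z : frobPow (IsLocalRing.ResidueField O) p e) :
    algebraMap (frobPow (IsLocalRing.ResidueField O) p e) (Trunc O p e) z =
      frobLift O p e ((frobPowEquiv (IsLocalRing.ResidueField O) p e).symm z) := rfl

/-- On a `q`-th power: `algebraMap ⟨(res x)^q⟩ = x^q`. [folklore] -/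
theorem algebraMap_frobPow_trunc_pow (x : Trunc O p e)
    (hx : truncRes O p e x ^ p ^ e ∈ frobPow (IsLocalRing.ResidueField O) p e) :
    algebraMap (frobPow (IsLocalRing.ResidueField O) p e) (Trunc O p e) ⟨truncRes O p e x ^ p ^ e, hx⟩ =
      x ^ p ^ e := by
  rw [algebraMap_frobPow_trunc, frobPowEquiv_symm_mk, frobLift_truncRes]

/-- `res` is a `κ^q`-algebra map: `res (algebraMap z) = z`. [folklore] -/
theorem truncRes_algebraMap (z : frobPow (IsLocalRing.ResidueField O) p e) :
    truncRes O p e (algebraMap (frobPow (IsLocalRing.ResidueField O) p e) (Trunc O p e) z) = (z : _) := by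
  rw [algebraMap_frobPow_trunc, truncRes_frobLift, frobPowEquiv_symm_pow]

/-- `res` as a `κ^q`-algebra homomorphism `O/𝔪^q → κ`. [folklore] -/
noncomputable def truncResAlg : Trunc O p e →ₐ[frobPow (IsLocalRing.ResidueField O) p e] IsLocalRing.ResidueField O :=
  { truncRes O p e with
    commutes' := fun z => truncRes_algebraMap O p e z }

/-- `res` as an algebra map, applied. [folklore] -/
@[simp] theorem truncResAlg_apply (x : Trunc O p e) : truncResAlg O p e x = truncRes O p e x := rfl

end TruncAlgebra

/-! ## Partial coefficient fields: lifting `κ^q(b)` into `O/𝔪^q` -/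

section CoeffLift

variable (O : Type v) [CommRing O] [IsLocalRing O] (p : ℕ) [hp : Fact p.Prime] [CharP O p] (e : ℕ)
  [CharP (IsLocalRing.ResidueField O) p] {s : ℕ} (b : Fin s → IsLocalRing.ResidueField O)

/-- Chosen lifts `ỹ_i ∈ O/𝔪^q` of the `b_i ∈ κ` (any lifts work). [folklore] -/
noncomputable def genLift (i : Fin s) : Trunc O p e := Classical.choose (truncRes_surjective O p e (b i))

omit [CharP O p] [CharP (IsLocalRing.ResidueField O) p] in
/-- `res ỹ_i = b_i`. [folklore] -/
@[simp] theorem truncRes_genLift (i : Fin s) : truncRes O p e (genLift O p e b i) = b i :=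
  Classical.choose_spec (truncRes_surjective O p e (b i))

/-- **The tower relation holds for ANY lift**: `ỹ_i^q = λ(b_i)` is the structure map applied to `x_i = b_i^q`.
[cite: Mizutani1973HironakaGroupSchemes, Lemma 2.4 (p. 88)] -/
theorem genLift_pow (i : Fin s) :
    genLift O p e b i ^ p ^ e =
      algebraMap (frobPow (IsLocalRing.ResidueField O) p e) (Trunc O p e) (towerPow e b i) := by
  have hmem : truncRes O p e (genLift O p e b i) ^ p ^ e ∈ frobPow (IsLocalRing.ResidueField O) p e :=
    pow_mem_frobPow e _
  have heq : towerPow e b i = ⟨truncRes O p e (genLift O p e b i) ^ p ^ e, hmem⟩ :=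
    Subtype.ext (by simp [towerPow])
  rw [heq, algebraMap_frobPow_trunc_pow]

variable {e b}

/-- **A partial coefficient field**: for a family `b` of `κ` whose box monomials of level `p^e` are
`κ^{p^e}`-independent, the `κ^{p^e}`-algebra map `σ : κ^{p^e}(b) → O/𝔪^{p^e}`, `b_i ↦ ỹ_i`, from the root-tower
universal property of `κ^{p^e}(b) ≅ κ^{p^e}[Y]/(Y_i^{p^e} − b_i^{p^e})` (`isRootTower_adjoin`).  It is a ring
homomorphism out of a field, injective, and lifts the inclusion `κ^{p^e}(b) ⊂ κ` (`truncRes_coeffLift`).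
[cite: Mizutani1973HironakaGroupSchemes, Lemma 2.4 (p. 88: K = k^q(c_1, …, c_m), c p-independent)] -/
noncomputable def coeffLift (hb : PIndep p e b) :
    towerField e b →ₐ[frobPow (IsLocalRing.ResidueField O) p e] Trunc O p e :=
  (isRootTower_adjoin hb).lift (genLift O p e b) (genLift_pow O p e b)

/-- `σ(b_i) = ỹ_i`. [folklore] -/
@[simp] theorem coeffLift_gen (hb : PIndep p e b) (i : Fin s) :
    coeffLift O p hb (towerGen e b i) = genLift O p e b i :=
  (isRootTower_adjoin hb).lift_apply_gen _ _ i

/-- **`σ` lifts the inclusion**: `res (σ w) = w` for every `w ∈ κ^{p^e}(b)`. [folklore] -/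
theorem truncRes_coeffLift (hb : PIndep p e b) (w : towerField e b) :
    truncRes O p e (coeffLift O p hb w) = (w : IsLocalRing.ResidueField O) := by
  have h : (truncResAlg O p e).comp (coeffLift O p hb) = (towerField e b).val :=
    (isRootTower_adjoin hb).algHom_ext fun i => by
      rw [AlgHom.comp_apply, coeffLift_gen, truncResAlg_apply, truncRes_genLift, IntermediateField.val_mk]
      rfl
  have hw := congrArg (fun ψ => ψ w) h
  simpa only [AlgHom.comp_apply, truncResAlg_apply, IntermediateField.coe_val] using hw

/-- `σ w − x ∈ 𝔪̄` whenever `res x = w`: the lift differs from any other lift by an element of `𝔪̄`. [folklore] -/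
theorem coeffLift_sub_mem_truncMax (hb : PIndep p e b) (w : towerField e b) {x : Trunc O p e}
    (hx : truncRes O p e x = (w : IsLocalRing.ResidueField O)) : coeffLift O p hb w - x ∈ truncMax O p e :=
  mem_truncMax_of_truncRes_eq_zero O p e (by rw [map_sub, truncRes_coeffLift, hx, sub_self])

end CoeffLift

/-! ## The kernel argument on `F ⊗_K F`, `K = k^q` -/

section TensorKer

variable {k : Type u} [Field k] (p : ℕ) [hp : Fact p.Prime] [CharP k p] (e : ℕ)
  (O : Type v) [CommRing O] [IsLocalRing O] [Algebra k O] [CharP O p] [CharP (IsLocalRing.ResidueField O) p]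

/-- `ι : k → O → O/𝔪^q`. [folklore] -/
noncomputable abbrev iotaTrunc : k →+* Trunc O p e := (truncMk O p e).comp (algebraMap k O)

/-- `φ : k → O → κ`. [folklore] -/
noncomputable abbrev phiRes : k →+* IsLocalRing.ResidueField O := (IsLocalRing.residue O).comp (algebraMap k O)

omit [CharP k p] [CharP O p] [CharP (IsLocalRing.ResidueField O) p] in
/-- `res ∘ ι = φ`. [folklore] -/
@[simp] theorem truncRes_iotaTrunc (c : k) : truncRes O p e (iotaTrunc p e O c) = phiRes O c := rfl

omit [CharP O p] [CharP (IsLocalRing.ResidueField O) p] in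
/-- The canonical `k^q`-algebra structure of `O/𝔪^q` is `ι` restricted. [folklore] -/
theorem algebraMap_frobPow_eq_iota (z : frobPow k p e) :
    algebraMap (frobPow k p e) (Trunc O p e) z = iotaTrunc p e O (z : k) :=
  (IsScalarTower.algebraMap_apply k O (Trunc O p e) (z : k)).trans rfl

variable {p e O} {s : ℕ} {b : Fin s → IsLocalRing.ResidueField O} (hb : PIndep p e b)
  (F : IntermediateField (frobPow k p e) k) (hF : ∀ x : F, phiRes O (x : k) ∈ towerField e b)

/-- `φ̂ : F → κ^q(b)` (the image of `F` lies in `κ^q(b)` by hypothesis). [folklore] -/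
noncomputable def phiHat : F →+* towerField e b :=
  ((phiRes O).comp (algebraMap F k)).codRestrict (towerField e b) hF

omit [CharP O p] in
/-- `φ̂ x = φ x` in `κ`. [folklore] -/
@[simp] theorem coe_phiHat (x : F) : ((phiHat F hF x : towerField e b) : IsLocalRing.ResidueField O) = phiRes O x :=
  rfl

/-- The first factor `ι|_F : F → O/𝔪^q` as a `k^q`-algebra map. [folklore] -/
noncomputable def iotaF : F →ₐ[frobPow k p e] Trunc O p e :=
  { (iotaTrunc p e O).comp (algebraMap F k) with
    commutes' := fun z => by
      show iotaTrunc p e O ((algebraMap (frobPow k p e) F z : F) : k) = algebraMap (frobPow k p e) (Trunc O p e) z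
      rw [algebraMap_frobPow_eq_iota]
      rfl }

omit [CharP O p] [CharP (IsLocalRing.ResidueField O) p] in
/-- The first factor applied: `ι(x)`. [folklore] -/
@[simp] theorem iotaF_apply (x : F) : iotaF F x = iotaTrunc p e O (x : k) := rfl

/-- **The second factor `σ ∘ φ̂ : F → κ^q(b) → O/𝔪^q` is a `k^q`-algebra map** — on `K = k^q` it agrees with
`ι` BECAUSE every element of `K` is a `q`-th power: `σ(φ̂(c^q)) = λ(φ c) = ι(c)^q = ι(c^q)`.
[cite: Oda1983HironakaGroupSchemeII, §2 (p. 1168: Diff(k/F^e(k)), F^e(k) the subfield of p^e-th powers)] -/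
noncomputable def sigmaPhi : F →ₐ[frobPow k p e] Trunc O p e :=
  { (coeffLift O p hb).toRingHom.comp (phiHat F hF) with
    commutes' := fun z => by
      show coeffLift O p hb (phiHat F hF (algebraMap (frobPow k p e) F z)) =
        algebraMap (frobPow k p e) (Trunc O p e) z
      obtain ⟨c, hc⟩ := mem_frobPow_iff.mp z.2
      have hmem : truncRes O p e (iotaTrunc p e O c) ^ p ^ e ∈ frobPow (IsLocalRing.ResidueField O) p e :=
        pow_mem_frobPow e _
      have hφ : phiHat F hF (algebraMap (frobPow k p e) F z) =
          algebraMap (frobPow (IsLocalRing.ResidueField O) p e) (towerField e b)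
            ⟨truncRes O p e (iotaTrunc p e O c) ^ p ^ e, hmem⟩ := by
        apply Subtype.ext
        show phiRes O (z : k) = truncRes O p e (iotaTrunc p e O c) ^ p ^ e
        rw [truncRes_iotaTrunc, ← map_pow, hc]
      rw [hφ, AlgHom.commutes, algebraMap_frobPow_trunc_pow, ← map_pow, hc, algebraMap_frobPow_eq_iota] }

/-- The second factor applied: `σ(φ̂ x)`. [folklore] -/
@[simp] theorem sigmaPhi_apply (x : F) : sigmaPhi hb F hF x = coeffLift O p hb (phiHat F hF x) := rfl

/-- **`Θ = ι ⊗ (σ ∘ φ̂) : F ⊗_K F → O/𝔪^q`**, `x ⊗ y ↦ ι(x)·σ(φ̂ y)`. [cite: EGAIV4, §16.8 (functionals on A ⊗ A / J^{m+1})] -/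
noncomputable def tensorKer : F ⊗[frobPow k p e] F →ₐ[frobPow k p e] Trunc O p e :=
  Algebra.TensorProduct.productMap (iotaF F) (sigmaPhi hb F hF)

/-- `Θ(x ⊗ y) = ι(x) σ(φ̂ y)`. [folklore] -/
@[simp] theorem tensorKer_tmul (x y : F) :
    tensorKer hb F hF (x ⊗ₜ[frobPow k p e] y) = iotaTrunc p e O (x : k) * coeffLift O p hb (phiHat F hF y) := by
  unfold tensorKer
  rw [Algebra.TensorProduct.productMap_apply_tmul, iotaF_apply, sigmaPhi_apply]

/-- **`Θ(J_F) ⊆ 𝔪̄`**: `Θ(1 ⊗ s − s ⊗ 1) = σ(φ̂ s) − ι(s)` has residue `φ s − φ s = 0`. [folklore] -/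
theorem map_tensorKer_ideal_le :
    (KaehlerDifferential.ideal (frobPow k p e) F).map (tensorKer hb F hF) ≤ truncMax O p e := by
  rw [← KaehlerDifferential.span_range_eq_ideal, Ideal.map_span, Ideal.span_le]
  rintro _ ⟨_, ⟨s, rfl⟩, rfl⟩
  rw [SetLike.mem_coe, map_sub, tensorKer_tmul, tensorKer_tmul, OneMemClass.coe_one, map_one, map_one, map_one,
    one_mul, mul_one]
  exact coeffLift_sub_mem_truncMax O p hb _ (by rw [truncRes_iotaTrunc]; rfl)

/-- **`Θ` kills `J_F^q`** (`Θ(J_F^q) ⊆ 𝔪̄^q = 0` in `O/𝔪^q`). [cite: EGAIV4, §16.8] -/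
theorem tensorKer_eq_zero_of_mem_pow {ω : F ⊗[frobPow k p e] F}
    (hω : ω ∈ KaehlerDifferential.ideal (frobPow k p e) F ^ p ^ e) : tensorKer hb F hF ω = 0 := by
  have h : tensorKer hb F hF ω ∈ (KaehlerDifferential.ideal (frobPow k p e) F ^ p ^ e).map (tensorKer hb F hF) :=
    Ideal.mem_map_of_mem _ hω
  rw [Ideal.map_pow] at h
  have h' := Ideal.pow_right_mono (map_tensorKer_ideal_le hb F hF) (p ^ e) h
  rwa [truncMax_pow_eq_bot, Ideal.mem_bot] at h'

/-- On a sum of pure tensors: `Θ(Σ_i x_i ⊗ y_i) = Σ_i ι(x_i) σ(φ̂ y_i)`. [folklore] -/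
theorem tensorKer_sum_tmul {ι : Type*} (t : Finset ι) (x y : ι → F) :
    tensorKer hb F hF (∑ i ∈ t, x i ⊗ₜ[frobPow k p e] y i) =
      ∑ i ∈ t, iotaTrunc p e O (x i : k) * coeffLift O p hb (phiHat F hF (y i)) := by
  rw [map_sum]
  exact Finset.sum_congr rfl fun i _ => tensorKer_tmul hb F hF (x i) (y i)

end TensorKer

end Summit.ResolutionOfSingularities.KangarooAtlas.Mizutani
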